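import Summits.HodgeConjecture.HodgeConjecture.Theorems.NikulinTwinTransportHodgeSimilitudeAlgebraicOfKugaSatake
import Summits.HodgeConjecture.HodgeConjecture.Theorems.NikulinTwinTransportRealMultiplicationOfTwoSelfSimilar
import Summits.HodgeConjecture.HodgeConjecture.Theorems.NikulinTwinTransportSquareGlueFree

/-!
# Route NikulinTwinTransport · crux `SquareHodgeOfSqrtTwo` (stmt-HodgeConjecture-13680) GRANTED KUGA–SATAKE:
# the Hodge conjecture for `S × S`, `S` a projective K3 surface with real multiplication by `ℚ(√2)`,
# from the Kuga–Satake Hodge conjecture for K3 surfaces and the marking fact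

`…NikulinTwinTransportHodgeSimilitudeAlgebraicOfKugaSatake` (this seat) proved the route's crux
`HodgeSimilitudeAlgebraic` and its target X `TwinSimilitudeAlgebraic` GRANTED `IsKSCorrespondenceAlgebraicBetti`
for every projective K3 surface, modulo the marking fact `Huybrechts_K3_marking_exists` (itself reduced in the tree
to `b₂ = 22` by `Huybrechts_K3_marking_exists_holds_of` + `K3_even_intersectionForm_holds` +
`K3_exists_orientation_signature_hodgeRiemann_ample_of_finrank_complexBetti_two`). Since the route's glue is PROVED
(`realMultiplicationSqrtTwoAlgebraic_of_twinSimilitude_of_marking`, `SquareGlueFree.squareGlue_proof`,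
`lefschetzOneOneK3_proof`), X gives on the same footing:

* `realMultiplicationSqrtTwoAlgebraic_of_kugaSatake` — the support item `RealMultiplicationSqrtTwoAlgebraic`
  (stmt-13679: real multiplication by `√2` on a projective K3 surface is cycle-induced);
* **`squareHodgeOfSqrtTwo_of_kugaSatake`** — THE CRUX `SquareHodgeOfSqrtTwo` (stmt-13680: `HodgeConjectureFor 4
  (S ⊗ S)` for every projective K3 surface `S` with `End_Hdg(T(S)_ℚ) = ℚ + ℚ·e`, `e² = 2` — the sector containing
  the maximal `8`-dimensional `ℚ(√2)`-families of van Geemen–Schütt);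
* `assembly_of_kugaSatake` — the frame `Assembly` (stmt-13942).

CONDITIONAL: every theorem takes `hKS : ∀ S, IsK3Surface S → IsKSCorrespondenceAlgebraicBetti _` (the Kuga–Satake
Hodge conjecture for K3 surfaces — OPEN in print for a general K3; van Geemen 2000 §10) and
`hMk : Huybrechts_K3_marking_exists`. Nothing here says that HC, the crux, or Kuga–Satake is proved. THEOREMS ONLY
(no `def`, no new named fact, no sorry). Prover seat hodge-nonav-19652-p1 (gen 15), `--supports stmt-HodgeConjecture-13680`.

References: M. Varesco, Math. Z. 305 (2023), Thm. 2.1, §4 and Thm. 5.3; B. van Geemen, in *The arithmetic and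
geometry of algebraic cycles* (2000) §10; D. Huybrechts, *Lectures on K3 Surfaces*, Ch. 1 Prop. 3.5, Ch. 4 §2.6;
B. van Geemen, M. Schütt, arXiv:2310.05196 §4.9 (the maximal `ℚ(√2)` families).
-/

set_option linter.dupNamespace false

noncomputable section

namespace Summit.HodgeConjecture.HodgeConjecture.Theorems.NikulinTwinTransport

open CategoryTheory Literature.AlgebraicGeometry Literature.AlgebraicGeometry.Motives
open Literature.AlgebraicGeometry.HodgeTheory Literature.AlgebraicGeometry.Surfaces
open Summit.HodgeConjecture.HodgeConjecture.Theses.NikulinTwinTransport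

/-- **Support item `RealMultiplicationSqrtTwoAlgebraic` (stmt-HodgeConjecture-13679: real multiplication by `√2`
on the transcendental lattice of a projective K3 surface is induced by an algebraic cycle) GRANTED Kuga–Satake
for all projective K3 surfaces**, modulo the marking fact — X at the pairs `(S, S)` through the route's proved
reduction `realMultiplicationSqrtTwoAlgebraic_of_twinSimilitude_of_marking`.
[cite: Varesco2023, Thm. 2.1, Rem. 2.2 and Thm. 5.3] [cite: Huybrechts2016K3, Ch. 1 Prop. 3.5] -/
theorem realMultiplicationSqrtTwoAlgebraic_of_kugaSatake (hMk : Huybrechts_K3_marking_exists)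
    (hKS : ∀ (S : SchemeOver ℂ) (hS : IsK3Surface S), IsKSCorrespondenceAlgebraicBetti hS.isSmoothProjective) :
    RealMultiplicationSqrtTwoAlgebraic :=
  realMultiplicationSqrtTwoAlgebraic_of_twinSimilitude_of_marking (twinSimilitudeAlgebraic_of_kugaSatake hMk hKS) hMk

/-- **THE CRUX `SquareHodgeOfSqrtTwo` (stmt-HodgeConjecture-13680) GRANTED KUGA–SATAKE: the Hodge conjecture for
`S × S` in degree `4`, for every projective K3 surface `S` whose algebra of Hodge endomorphisms of `T(S)_ℚ` is
`ℚ + ℚ·e` with `e² = 2`, follows from the Kuga–Satake Hodge conjecture for projective K3 surfaces**, modulo the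
marking fact: X at `(S, S)` makes `e` cycle-induced (`realMultiplicationSqrtTwoAlgebraic_of_kugaSatake`), and the
route's PROVED Künneth glue `SquareGlueFree.squareGlue_proof` (with `lefschetzOneOneK3_proof`) assembles
`HodgeConjectureFor 4 (S ⊗ S)`. CONDITIONAL on Kuga–Satake (open for a general K3).
[cite: Varesco2023, Thm. 2.1 and Thm. 5.3] [cite: vanGeemen2000KugaSatakeHC, §10.2–10.3]
[cite: Huybrechts2016K3, Ch. 1 Prop. 3.5] -/
theorem squareHodgeOfSqrtTwo_of_kugaSatake (hMk : Huybrechts_K3_marking_exists)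
    (hKS : ∀ (S : SchemeOver ℂ) (hS : IsK3Surface S), IsKSCorrespondenceAlgebraicBetti hS.isSmoothProjective) :
    SquareHodgeOfSqrtTwo :=
  SquareGlueFree.squareGlue_proof (realMultiplicationSqrtTwoAlgebraic_of_kugaSatake hMk hKS) lefschetzOneOneK3_proof

/-- **The frame `Assembly` (stmt-HodgeConjecture-13942) GRANTED Kuga–Satake**: of its hypotheses only Lefschetz
`(1,1)` is used; the proved glue `squareGlue_proof` and the declared sector complement decide the summit. Modulo
the marking fact. [cite: Varesco2023, Thm. 5.3] [cite: Huybrechts2016K3, Ch. 1 Prop. 3.5] -/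
theorem assembly_of_kugaSatake (hMk : Huybrechts_K3_marking_exists)
    (hKS : ∀ (S : SchemeOver ℂ) (hS : IsK3Surface S), IsKSCorrespondenceAlgebraicBetti hS.isSmoothProjective) :
    Assembly :=
  fun _ _ _ hL hSC => hSC (SquareGlueFree.squareGlue_proof (realMultiplicationSqrtTwoAlgebraic_of_kugaSatake hMk hKS) hL)

end Summit.HodgeConjecture.HodgeConjecture.Theorems.NikulinTwinTransport

end
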